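import Summits.Ventures.Crystal3D.Theorems.StickyWulffConstantGenericWallFloorStackWalkInjectiveSteer
import HarnessLib

/-!
# `top ↦ end state` is injective for ANY steering vector — grain 2 (walkers launched DOWNWARD from the top sample)
# (crux `GenericWallFloor`, stmt-Ventures-19480, line `WallLedgerG`; mirror of `…StackWalkInjectiveSteer`)

HONEST FRAMING. Venture `Summits/Ventures/Crystal3D` (cell `crystal3d-full`), helper `--supports` the crux
`GenericWallFloor` of `route-Ventures-StickyWulffConstant`, REGISTERED line `WallLedgerG`, open stub
`stub_twoSlabAdhesion`.  Structure only (census-free); F-C1 not moved; NOT the crux, no ledger here.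

`…StackWalkInjectiveSteer` (19480-p1 g8) proves the steering-free injectivity of `top ↦ end state` for a family whose launch
slot RISES in true height (`0 < δ ≤ (A u)₂`) above the FLOOR of the configuration (`∀ q ∈ X, a ≤ q₂`): the backward line
of a bottom state descends, so it is short, stays in the sealed sample, and meets no twin cap
(`not_twinCap_of_floor_sample`).  This file is the MIRROR for the top grain, whose walkers are launched DOWNWARD
(`0 < δ ≤ −(A u)₂`) below the CEILING (`∀ q ∈ X, q₂ ≤ b`): the backward line ascends toward the ceiling and
`not_twinCap_of_ceiling_sample` (`…SealedStates`) excludes the pops.  Same proofs, inequalities reversed: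
* `walkRun_back_line_down`, `walkRun_ne_start_steer_down`, **`walkRun_start_injective_steer_down`** — tops region: balls
  FULL in `A`, height `≥ a + 1`, lateral radius `≤ r`, room `r + (b − 1 − a)/δ ≤ ρ − 2`.
It is the injectivity input of the DOWN twin of the W1-conditional one-sided ledger (`…StackLedgerOneSidedDirs`, 19480-p2 g8).
WHAT THIS IS NOT: no ledger; F-C1 not moved.
-/

noncomputable section

namespace Summit.Ventures.Crystal3D.Theorems

open Finset
open Literature.MathematicalPhysics.StatisticalMechanics (fccStacking)
open scoped InnerProductSpace

variable {X : Finset (EuclideanSpace ℝ (Fin 3))}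

section SteerDown

variable (hX : ∀ p ∈ X, ∀ q ∈ X, p ≠ q → 1 ≤ dist p q)
  {s₀ : EuclideanSpace ℝ (Fin 3)} (hs₀ : s₀ ∈ fccSlots)
  (hcert : ExactOnly 0 (fccSlots.filter fun w => 0 < ⟪w, s₀⟫_ℝ))
  {z : EuclideanSpace ℝ (Fin 3)} (hz : ‖z‖ = 1)
  (A : EuclideanSpace ℝ (Fin 3) ≃ₗᵢ[ℝ] EuclideanSpace ℝ (Fin 3)) (t₀ : EuclideanSpace ℝ (Fin 3))
  {u : EuclideanSpace ℝ (Fin 3)} (hu : u ∈ fccSlots) (hsteep : Real.sqrt 2 / 2 ≤ ⟪A u, z⟫_ℝ)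
  {δ : ℝ} (hδ : 0 < δ) (hdown : δ ≤ -(A u) 2)
  (P : Finset (EuclideanSpace ℝ (Fin 3))) {a b ρ r : ℝ} (hρ2 : 2 ≤ ρ) (hab : a + 2 ≤ b) (hPX : P ⊆ X)
  (hP : ∀ p, p ∈ P ↔ (p ∈ (fun q => A q + t₀) '' fccStacking 1 (Real.sqrt (2 / 3)) ∧
    a ≤ p 2 ∧ p 2 ≤ b ∧ p 0 ^ 2 + p 1 ^ 2 ≤ ρ ^ 2))
  (hceil : ∀ q ∈ X, q 2 ≤ b) (hr : 0 ≤ r) (hroom : r + (b - 1 - a) / δ ≤ ρ - 2)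

include hX hs₀ hcert hz hu hδ hdown hρ2 hab hPX hP hceil hr hroom in
/-- **The backward line (downward family).**  `s` valid (`WalkInv`, `StackWF`), at time `k` in the bottom state at a lattice
ball `q` of the top sample's column (`q₂ ≥ a + 1`, lateral radius `≤ r`), having moved at every time `< k`: then for every
`j ≤ k` the state at time `k − j` is `(q − j·A u, [⟨A, u, 0⟩])`. -/
theorem walkRun_back_line_down {s : EuclideanSpace ℝ (Fin 3) × List WalkEntry} (hI : WalkInv X z s) (hW : StackWF z s.2)
    {k : ℕ} {q : EuclideanSpace ℝ (Fin 3)} (hq : walkRun X z k s = (q, [⟨A, u, 0⟩]))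
    (hqΛ : q ∈ (fun p => A p + t₀) '' fccStacking 1 (Real.sqrt (2 / 3))) (hqa : a + 1 ≤ q 2)
    (hqr : q 0 ^ 2 + q 1 ^ 2 ≤ r ^ 2) (hmoves : ∀ τ, τ < k → walkStep X z (walkRun X z τ s) ≠ none) :
    ∀ j, j ≤ k → walkRun X z (k - j) s = (q - (j : ℝ) • A u, [⟨A, u, 0⟩]) := by
  have hAu : ‖A u‖ = 1 := by rw [LinearIsometryEquiv.norm_map, norm_eq_one_of_mem_fccSlots hu]
  intro j
  induction j with
  | zero => intro _; simpa using hq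
  | succ j IH =>
    intro hjk
    have hj : j ≤ k := Nat.le_of_succ_le hjk
    have hprev := IH hj
    -- the state one step earlier
    set τ := k - (j + 1) with hτ
    have hτk : τ < k := by omega
    have hτ1 : k - j = τ + 1 := by omega
    obtain ⟨hIτ, hWτ⟩ := walkRun_valid hX hs₀ hcert hz τ hI hW
    have hstep1 : walkRun X z 1 (walkRun X z τ s) = (q - (j : ℝ) • A u, [⟨A, u, 0⟩]) := by
      rw [← walkRun_succ', ← hτ1]; exact hprev
    -- it moved at time `τ`
    rcases hws : walkRun X z τ s with ⟨yw, stk⟩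
    rw [hws] at hIτ hWτ hstep1
    cases hst : walkStep X z (yw, stk) with
    | none => exact absurd hst (by have := hmoves τ hτk; rwa [hws] at this)
    | some v =>
      rw [walkRun_succ_of_some X z 0 hst, walkRun_zero] at hstep1
      subst hstep1
      obtain ⟨hywX, hSw, ew, rw', hstk, -⟩ := hIτ
      simp only at hstk hSw hywX
      subst hstk
      rcases walkStep_cases hst with ⟨-, hs⟩ | ⟨n, hcap, ⟨e', rest', hrr, hn, hs⟩ | ⟨-, hs⟩⟩
      · -- FULL: the predecessor is `q − (j+1)·A u` with the bottom stack
        injection hs with hy hl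
        injection hl with hew hrw
        subst hew; subst hrw
        have hy : yw + A u = q - (j : ℝ) • A u := by first | exact hy | exact hy.symm
        have hyw : yw = q - ((j + 1 : ℕ) : ℝ) • A u := by
          rw [eq_sub_iff_add_eq] at hy ⊢
          rw [← hy]; push_cast; module
        rw [hyw]
      · -- POP: `yw = q − (j+1)·A u` would be a twin cap at a lattice ball of the sample column: impossible
        exfalso
        subst hrr
        injection hs with hy hl
        injection hl with he' hrest
        subst he'
        have hy : yw + A u = q - (j : ℝ) • A u := by first | exact hy | exact hy.symm
        have hyw : yw = q - ((j + 1 : ℕ) : ℝ) • A u := by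
          rw [eq_sub_iff_add_eq] at hy ⊢
          rw [← hy]; push_cast; module
        obtain ⟨hSo, hLi, -⟩ := hSw
        obtain ⟨hdir, hnn, hmenu₁, -, -, -, -⟩ := hSo
        subst hn
        -- the lower frame is `A`, the upper its twin across `ew.nrm`
        have hback : ∀ x, A x = ew.frame x - (2 * ⟪ew.frame x, ew.nrm⟫_ℝ) • ew.nrm := twin_symm A ew.frame hnn hLi.1
        have hmenuA := menu_reflect ew.frame A hnn hmenu₁ hback
        -- `yw` is a lattice ball, above `a + 1`, off the rim by `2`
        have hywΛ : yw ∈ (fun p => A p + t₀) '' fccStacking 1 (Real.sqrt (2 / 3)) := by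
          rw [hyw]; exact sub_natCast_smul_mem_movedFcc A t₀ hqΛ hu (j + 1)
        have hy2 : yw 2 = q 2 - ((j + 1 : ℕ) : ℝ) * (A u) 2 := by
          rw [hyw]; simp [PiLp.sub_apply, PiLp.smul_apply]
        have hjpos : (0 : ℝ) ≤ ((j + 1 : ℕ) : ℝ) := by positivity
        have hywa : a + 1 ≤ yw 2 := by
          rw [hy2]; nlinarith [mul_nonneg hjpos (hδ.le.trans hdown)]
        -- the number of backward steps is bounded by the ceiling: `(j+1)·δ ≤ b − 1 − a`
        have hyb : yw 2 ≤ b := hceil yw hywX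
        have hsteps : ((j + 1 : ℕ) : ℝ) ≤ (b - 1 - a) / δ := by
          rw [le_div_iff₀ hδ]
          have h1 : ((j + 1 : ℕ) : ℝ) * δ ≤ ((j + 1 : ℕ) : ℝ) * (-(A u) 2) := mul_le_mul_of_nonneg_left hdown hjpos
          linarith [hy2, hyb, hqa]
        have hywr : yw 0 ^ 2 + yw 1 ^ 2 ≤ (ρ - 2) ^ 2 := by
          have h1 := lateral_sq_sub_natCast_smul_le hr hAu hqr (j + 1)
          rw [← hyw] at h1
          have h2 : r + ((j + 1 : ℕ) : ℝ) ≤ ρ - 2 := by linarith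
          have h3 : 0 ≤ r + ((j + 1 : ℕ) : ℝ) := by positivity
          exact h1.trans (by nlinarith)
        exact not_twinCap_of_ceiling_sample hX A t₀ P a b ρ hρ2 hab hPX hP hceil hywΛ hywa hywr ew.frame hnn hmenuA
          hLi.1 ew.dir hcap
      · -- PUSH: two levels
        exfalso
        rw [pushMove_eq] at hs
        injection hs with _ hl
        injection hl with _ hl'
        first | exact List.cons_ne_nil _ _ hl' | exact List.cons_ne_nil _ _ hl'.symm

include hX hs₀ hcert hz hu hsteep hδ hdown hρ2 hab hPX hP hceil hr hroom in
/-- **No walker visits the start state of another top — any steering, downward family.**  `S ⊆ P` the tops' region (balls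
FULL in `A`, height `≥ a + 1`, lateral radius `≤ r`), run-convex along `A u`; if the walker launched from the top `t′ ∈ S` is
at time `i` in the start state `(t + A u, [⟨A,u,0⟩])` of `t ∈ S`, then `t = t′`. -/
theorem walkRun_ne_start_steer_down (S : Finset (EuclideanSpace ℝ (Fin 3))) (hSP : S ⊆ P)
    (hS : ∀ p ∈ S, a + 1 ≤ p 2 ∧ p 0 ^ 2 + p 1 ^ 2 ≤ r ^ 2) (hfullS : ∀ p ∈ S, ∀ w ∈ fccSlots, p + A w ∈ X)
    (hconv : ∀ p ∈ S, ∀ i : ℕ, 1 ≤ i → p + ((i : ℕ) : ℝ) • A u ∈ S → p + A u ∈ S)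
    {t t' : EuclideanSpace ℝ (Fin 3)} (ht : t ∈ S) (ht' : t' ∈ S) (htop' : t' + A u ∉ S) :
    ∀ i : ℕ, walkRun X z i (t' + A u, [⟨A, u, 0⟩]) = (t + A u, [⟨A, u, 0⟩]) → t = t' := by
  intro i
  induction i with
  | zero =>
    intro h
    rw [walkRun_zero] at h
    exact (add_right_cancel (Prod.mk.inj h).1).symm
  | succ i IH =>
    intro h
    have ht'X : t' ∈ X := hPX (hSP ht')
    have hI₀ : WalkInv X z (t' + A u, [⟨A, u, 0⟩]) := walkInv_start A ht'X (hfullS t' ht') hu hsteep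
    have hW₀ : StackWF z ([⟨A, u, 0⟩] : List WalkEntry) := stackWF_start z A u
    rw [walkRun_succ'] at h
    obtain ⟨hwI, hwW⟩ := walkRun_valid hX hs₀ hcert hz i hI₀ hW₀
    rcases hws : walkRun X z i (t' + A u, [⟨A, u, 0⟩]) with ⟨yw, stk⟩
    rw [hws] at h hwI hwW
    cases hstep : walkStep X z (yw, stk) with
    | none =>
      rw [walkRun_succ_of_none X z 0 hstep] at h
      exact IH (hws.trans h)
    | some v =>
      rw [walkRun_succ_of_some X z 0 hstep, walkRun_zero] at h
      subst h
      obtain ⟨-, hSw, ew, rw', hstk, -⟩ := hwI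
      simp only at hstk hSw
      subst hstk
      rcases walkStep_cases hstep with ⟨-, hs⟩ | ⟨n, hcap, ⟨e', rest', hrr, hn, hs⟩ | ⟨-, hs⟩⟩
      · -- FULL: the walker was at `(t, bottom)` at time `i`, having moved at all times `≤ i`; run the backward line
        injection hs with hy hl
        injection hl with hew hrw
        subst hew; subst hrw
        have hy' : yw + A u = t + A u := by first | exact hy | exact hy.symm
        have hyt : t = yw := (add_right_cancel hy').symm
        subst hyt
        have hmoves : ∀ τ, τ < i → walkStep X z (walkRun X z τ (t' + A u, [⟨A, u, 0⟩])) ≠ none := by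
          intro τ hτ
          have hi : walkStep X z (walkRun X z i (t' + A u, [⟨A, u, 0⟩])) ≠ none := by rw [hws, hstep]; simp
          exact walkStep_ne_none_of_later z _ hτ.le hi
        have hline := walkRun_back_line_down hX hs₀ hcert hz A t₀ hu hδ hdown P hρ2 hab hPX hP hceil hr hroom hI₀ hW₀
          hws ((hP _).1 (hSP ht)).1 (hS _ ht).1 (hS _ ht).2 hmoves i le_rfl
        rw [Nat.sub_self, walkRun_zero] at hline
        have hpos : t' + A u = t - (i : ℝ) • A u := (Prod.mk.inj hline).1
        -- so `t = t′ + (i+1)·A u` lies on `t′`'s line inside `S`: `t′` is not a top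
        have hti : t' + (((i + 1 : ℕ)) : ℝ) • A u = t := by
          rw [eq_sub_iff_add_eq] at hpos
          rw [← hpos]; push_cast; module
        exact absurd (hconv t' ht' (i + 1) (by omega) (by rw [hti]; exact ht)) htop'
      · -- POP: `t` would be an exact cap of the twin frame, but `t` is full in `A`
        exfalso
        subst hrr
        injection hs with hy hl
        injection hl with he' hrest
        subst he'
        have hy' : yw + A u = t + A u := by first | exact hy | exact hy.symm
        have hyt : t = yw := (add_right_cancel hy').symm
        subst hyt
        subst hn
        obtain ⟨hSo, hLi, -⟩ := hSw
        exact false_of_full_of_pop hX hSo hLi hcap (hfullS _ ht)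
      · -- PUSH: the stack would have two levels
        exfalso
        rw [pushMove_eq] at hs
        injection hs with _ hl
        injection hl with _ hl'
        first | exact List.cons_ne_nil _ _ hl' | exact List.cons_ne_nil _ _ hl'.symm

include hX hs₀ hcert hz hu hsteep hδ hdown hρ2 hab hPX hP hceil hr hroom in
/-- **`top ↦ end state` is injective for any steering, downward family.**  Two tops of `S` whose walks are in the same state
after `N` steps are equal. -/
theorem walkRun_start_injective_steer_down (S : Finset (EuclideanSpace ℝ (Fin 3))) (hSP : S ⊆ P)
    (hS : ∀ p ∈ S, a + 1 ≤ p 2 ∧ p 0 ^ 2 + p 1 ^ 2 ≤ r ^ 2) (hfullS : ∀ p ∈ S, ∀ w ∈ fccSlots, p + A w ∈ X)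
    (hconv : ∀ p ∈ S, ∀ i : ℕ, 1 ≤ i → p + ((i : ℕ) : ℝ) • A u ∈ S → p + A u ∈ S)
    {t t' : EuclideanSpace ℝ (Fin 3)} (ht : t ∈ S) (htop : t + A u ∉ S) (ht' : t' ∈ S) (htop' : t' + A u ∉ S) {N : ℕ}
    (h : walkRun X z N (t + A u, [⟨A, u, 0⟩]) = walkRun X z N (t' + A u, [⟨A, u, 0⟩])) : t = t' := by
  have hI : WalkInv X z (t + A u, [⟨A, u, 0⟩]) := walkInv_start A (hPX (hSP ht)) (hfullS t ht) hu hsteep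
  have hI' : WalkInv X z (t' + A u, [⟨A, u, 0⟩]) := walkInv_start A (hPX (hSP ht')) (hfullS t' ht') hu hsteep
  rcases walkRun_eq_walkRun_orbit hX hs₀ hcert hz N hI (stackWF_start z A u) hI' (stackWF_start z A u) h with
    ⟨j, hj⟩ | ⟨j, hj⟩
  · exact (walkRun_ne_start_steer_down hX hs₀ hcert hz A t₀ hu hsteep hδ hdown P hρ2 hab hPX hP hceil hr hroom S hSP hS
      hfullS hconv ht' ht htop j hj).symm
  · exact walkRun_ne_start_steer_down hX hs₀ hcert hz A t₀ hu hsteep hδ hdown P hρ2 hab hPX hP hceil hr hroom S hSP hS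
      hfullS hconv ht ht' htop' j hj

end SteerDown

end Summit.Ventures.Crystal3D.Theorems

end
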